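import Summits.NavierStokesRegularity.NavierStokesRegularity.Theses.StretchingWellBinding
import Summits.NavierStokesRegularity.NavierStokesRegularity.Theses.TypeIQuarterGate
import Summits.NavierStokesRegularity.NavierStokesRegularity.Theses.LerayQuarterDissipation
import Summits.NavierStokesRegularity.NavierStokesRegularity.Theorems.LerayQuarterDissipationRecordTimeTypeI
import Literature.Analysis.FunctionSpaces.WeakLp
import HarnessLib.Audit

/-!
# Line «trace_transfer», weak-L³ TWIN («weak_trace») on the shelf crux `StretchingWellBinding.EnstrophyQuarterLaw`
# (stmt-NavierStokesRegularity-1574): on the shelf, TIQG's open crux `LorentzUpgradeTypeI` (stmt-24108) is a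
# statement about ONE slice

Seat ns-idea-9, generation 4, lens «wuc»; twin of `Lines/trace_transfer.lean` (same lever — trace transfer under
the edge law — run in the Lorentz quasi-norm instead of L³). No summit is proved by this line; nothing here proves
the quarter law, `LorentzUpgradeTypeI`, or Clay (A).

THE STATEMENT. Put `WeakL3Trace` := "the terminal slice u(T) of a maximal Fefferman-class solution is in weak-L³,
sup_μ μ³|{|u(T)| > μ}| < ∞". It is a consequence of the summit (vacuously), it is GENUINELY WEAKER than the summit
in plausibility (a self-similar / DSS Type-I blow-up has |u(T,x)| ≲ |x − x₀|⁻¹ ∈ L^{3,∞}: it HOLDS at the model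
blow-ups, unlike `L3Trace`), and on the quarter-law shelf it is EQUIVALENT to the conclusion of TypeIQuarterGate's
open crux `LorentzUpgradeTypeI` (stmt-24108: sup-rate Type I ⇒ uniformly bounded weak-L³ slices):

  `EnstrophyQuarterLaw → (LorentzUpgradeTypeI ↔ WeakL3Trace)`   (kernel-checked below modulo five stubs).

So on shelf 1574 the additive scale-invariant quantity critic idea-crit-3 asked TIQG for (the weak-L³ cell count,
consumed by Barker 2024 Thm 2 / Barker–Prange 2021 Cor 9 and by TIQG's `LorentzCountTypeI`) is decided by the
terminal slice alone: the quarter law pays every level above the self-similar threshold λ(s) = (T−s)^{-1/2}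
(Sobolev L⁶: μ³|{|u(s)|>μ}| ≤ ‖u(s)‖₆⁶/μ³ ≤ C_S⁶K³ for μ ≥ λ(s)), and below λ(s) the EDGE LAW
‖u(s) − u(T)‖₂² ≤ D√(T−s) transfers the weak-L³ bound of u(T):
  μ³|{|u(s)|>μ}| ≤ μ³(|{|u(T)|>μ/2}| + |{|u(s)−u(T)|>μ/2}|) ≤ 8‖u(T)‖³_{3,∞} + 4μ‖u(s)−u(T)‖₂² ≤ 8N + 4D   (μ ≤ λ(s), μ√(T−s) ≤ 1).
Conversely bounded weak-L³ slices pass to u(T) along the STRONG L² convergence u(s) → u(T) given by the edge law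
(a.e. subsequence + Fatou on level sets) — no duality needed.

Ladder meaning: cross-route edge (1574 ∧ WeakL3Trace) → 24108-conclusion and 24108|_{shelf} → WeakL3Trace; with
TIQG's PROVED/printed consumers this puts the EQL-shelf blow-up with a weak-L³ terminal slice inside the printed
"Lorentz Type-I" class (finitely many singular points with weak-L³ scar floors: Barker–Prange 2021 Props 7–9, tree
facts). Instrument row: the weak-L³ quasi-norm of the terminal profile in blow-up data (finite ⟺ tame/enveloped;
a "satellite staircase" u(T) ∉ L^{3,∞} is the only way an EQL blow-up can escape the Lorentz class).
bears_on: stmt-1574 (shelf), stmt-24108 (target BY NAME, both directions), stmt-23843 ScarEnvelopeTypeI (its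
envelope at time T implies WeakL3Trace), stmt-26463 (shares `stub_edgeLaw`).
-/

set_option linter.dupNamespace false
set_option linter.unusedVariables false

noncomputable section

open MeasureTheory Set Function Metric
open scoped ENNReal NNReal

namespace Summit.NavierStokesRegularity.NavierStokesRegularity.Cruxes.EnstrophyQuarterLaw.WeakTrace

open Literature.Analysis.FluidPDE Literature.Analysis.FunctionSpaces

/-! ### Currencies (per solution) — `SliceLaw`, `EdgeBound`, `EdgeLaw` verbatim as in `Lines/trace_transfer.lean` -/

/-- SLICE LAW with constant `K` (body of `EnstrophyQuarterLaw`'s conclusion). -/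
def SliceLaw (T : ℝ) (u : ℝ → EuclideanSpace ℝ (Fin 3) → EuclideanSpace ℝ (Fin 3)) (K : ℝ) : Prop :=
  ∀ t ∈ Set.Ico 0 T, ∫⁻ x, ‖curl (u t) x‖ₑ ^ 2 ≤ ENNReal.ofReal (K / Real.sqrt (T - t))

/-- EDGE BOUND `‖u(s) − u(T)‖₂² ≤ D √(T−s)` on `[t₀,T)`. -/
def EdgeBound (T : ℝ) (u : ℝ → EuclideanSpace ℝ (Fin 3) → EuclideanSpace ℝ (Fin 3)) (D t₀ : ℝ) : Prop :=
  ∀ s ∈ Set.Ico t₀ T, ∫⁻ x, ‖u s x - u T x‖ₑ ^ 2 ≤ ENNReal.ofReal (D * Real.sqrt (T - s))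

/-- FAST-LEVEL WEAK-L³ BOUND: every level `μ ≥ λ(s) = (T−s)^{-1/2}` of `u(s)` is paid, `μ³|{|u(s)|>μ}| ≤ C`. -/
def FastWeakL3Bound (T : ℝ) (u : ℝ → EuclideanSpace ℝ (Fin 3) → EuclideanSpace ℝ (Fin 3)) (C t₀ : ℝ) : Prop :=
  ∀ s ∈ Set.Ico t₀ T, ∀ μ : ℝ≥0, (Real.sqrt (T - s))⁻¹ ≤ (μ : ℝ) →
    (μ : ℝ≥0∞) ^ (3 : ℝ) * volume {x | (μ : ℝ≥0∞) < ‖u s x‖ₑ} ≤ ENNReal.ofReal C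

/-- EDGE LAW (obligation Prop, shared with `Lines/trace_transfer.lean` and the NoTerminalJolt lead's plan). -/
def EdgeLaw : Prop :=
  ∀ (ν T : ℝ), 0 < ν → 0 < T →
    ∀ (u : ℝ → EuclideanSpace ℝ (Fin 3) → EuclideanSpace ℝ (Fin 3)) (p : ℝ → EuclideanSpace ℝ (Fin 3) → ℝ),
      IsClassicalNSSolutionOn (Set.Ico 0 T) ν 0 u p → IsLerayHopfOn T ν 0 (u 0) u →
      HasRapidSpatialDecay (u 0) → ∀ K : ℝ, SliceLaw T u K →
      ∃ D t₀ : ℝ, 0 ≤ t₀ ∧ t₀ < T ∧ EdgeBound T u D t₀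

/-- **WeakL3Trace** — the «wuc» currency of the twin: the terminal slice of a maximal Fefferman-class solution is
in weak-`L³`. Consequence of the summit (vacuous); TRUE at self-similar/DSS-type Type-I model blow-ups
(`|u(T,x)| ≲ |x−x₀|⁻¹`), so strictly weaker than the summit in plausibility; on the shelf it is EQUIVALENT to the
conclusion of TIQG's open crux `LorentzUpgradeTypeI` (stmt-24108). -/
def WeakL3Trace : Prop :=
  ∀ (ν T : ℝ), 0 < ν → 0 < T →
    ∀ (u : ℝ → EuclideanSpace ℝ (Fin 3) → EuclideanSpace ℝ (Fin 3)) (p : ℝ → EuclideanSpace ℝ (Fin 3) → ℝ),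
      IsMaximalSmoothSolution ν 0 u p T → IsLerayHopfOn T ν 0 (u 0) u → HasRapidSpatialDecay (u 0) →
      eWeakLpPow (u T) 3 volume < ⊤

/-! ### Registered stubs -/

/-- STUB 1 (L; shared): the slice law implies the edge law. -/
theorem stub_edgeLaw : EdgeLaw := by
  sorry

/-- STUB 2 (M; Sobolev `Ḣ¹ ⊂ L⁶` + Chebyshev in `L⁶`): the slice law pays every level above the self-similar
threshold: `μ³|{|u(s)|>μ}| ≤ ‖u(s)‖₆⁶/μ³ ≤ C_S⁶ K³ (T−s)^{-3/2} μ^{-3} ≤ C_S⁶K³` for `μ ≥ (T−s)^{-1/2}`. -/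
theorem stub_fastWeakL3 :
    ∀ (ν T : ℝ), 0 < ν → 0 < T →
      ∀ (u : ℝ → EuclideanSpace ℝ (Fin 3) → EuclideanSpace ℝ (Fin 3)) (p : ℝ → EuclideanSpace ℝ (Fin 3) → ℝ),
        IsClassicalNSSolutionOn (Set.Ico 0 T) ν 0 u p → IsLerayHopfOn T ν 0 (u 0) u →
        HasRapidSpatialDecay (u 0) → ∀ K : ℝ, SliceLaw T u K → ∃ C : ℝ, FastWeakL3Bound T u C 0 := by
  sorry

/-- STUB 3 (M; pure measure theory — WEAK TRACE TRANSFER): edge bound + fast-level bound + `u T ∈ L^{3,∞}` ⇒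
the weak-`L³` quasi-norms of the late slices are bounded (`μ³|{|u(s)|>μ}| ≤ 8N + 4μD√(T−s)` for `μ ≤ λ(s)`). -/
theorem stub_weakTransfer :
    ∀ (ν T : ℝ), 0 < ν → 0 < T →
      ∀ (u : ℝ → EuclideanSpace ℝ (Fin 3) → EuclideanSpace ℝ (Fin 3)) (p : ℝ → EuclideanSpace ℝ (Fin 3) → ℝ),
        IsClassicalNSSolutionOn (Set.Ico 0 T) ν 0 u p → IsLerayHopfOn T ν 0 (u 0) u →
        ∀ (D t₀ C : ℝ), 0 ≤ t₀ → t₀ < T → EdgeBound T u D t₀ → FastWeakL3Bound T u C 0 →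
        eWeakLpPow (u T) 3 volume < ⊤ →
        ∃ M' : ℝ, ∀ s ∈ Set.Ico t₀ T, eWeakLpPow (u s) 3 volume ≤ ENNReal.ofReal M' := by
  sorry

/-- STUB 4 (S/M; early times): a Fefferman-class solution has bounded weak-`L³` slices on every `[0,t₀]`,
`t₀ < T` — bounded on the sub-slab (Tao 2013 Cor 11.1, tree) and `μ³|{|u|>μ}| ≤ (sup|u|)·‖u‖₂²`. -/
theorem stub_weakL3_early :
    ∀ (ν T : ℝ), 0 < ν → 0 < T →
      ∀ (u : ℝ → EuclideanSpace ℝ (Fin 3) → EuclideanSpace ℝ (Fin 3)) (p : ℝ → EuclideanSpace ℝ (Fin 3) → ℝ),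
        IsClassicalNSSolutionOn (Set.Ico 0 T) ν 0 u p → IsLerayHopfOn T ν 0 (u 0) u →
        HasRapidSpatialDecay (u 0) → ∀ t₀ : ℝ, t₀ < T →
        ∃ M' : ℝ, ∀ s ∈ Set.Icc 0 t₀, eWeakLpPow (u s) 3 volume ≤ ENNReal.ofReal M' := by
  sorry

/-- STUB 5 (M−; converse, measure theory): bounded weak-`L³` slices pass to the terminal slice along the STRONG
`L²` convergence `u(s) → u(T)` supplied by the edge bound (a.e. subsequence + Fatou on level sets). -/
theorem stub_trace_of_slices :
    ∀ (ν T : ℝ), 0 < ν → 0 < T →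
      ∀ (u : ℝ → EuclideanSpace ℝ (Fin 3) → EuclideanSpace ℝ (Fin 3)) (p : ℝ → EuclideanSpace ℝ (Fin 3) → ℝ),
        IsClassicalNSSolutionOn (Set.Ico 0 T) ν 0 u p → IsLerayHopfOn T ν 0 (u 0) u →
        ∀ (D t₀ : ℝ), t₀ < T → EdgeBound T u D t₀ →
        (∃ M' : ℝ, ∀ s ∈ Set.Ico t₀ T, eWeakLpPow (u s) 3 volume ≤ ENNReal.ofReal M') →
        eWeakLpPow (u T) 3 volume < ⊤ := by
  sorry

/-! ### Kernel-checked compositions (no `sorry` below) -/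

/-- **On the shelf, a weak-L³ terminal slice gives TIQG's Lorentz upgrade** (stmt-1574 ∧ WeakL3Trace ⇒ stmt-24108;
the Type-I hypothesis of 24108 is not even used — the quarter law pays the fast levels). -/
theorem lorentzUpgradeTypeI_of_enstrophyQuarterLaw_of_weakL3Trace
    (hQ : Theses.StretchingWellBinding.EnstrophyQuarterLaw) (hW : WeakL3Trace) :
    Theses.TypeIQuarterGate.LorentzUpgradeTypeI := by
  intro ν T hν hT u p hmax hLH hdec _hI
  obtain ⟨K, hK⟩ := hQ ν T hν hT u p hmax hLH hdec
  obtain ⟨D, t₀, ht₀, ht₀T, hD⟩ := stub_edgeLaw ν T hν hT u p hmax.1 hLH hdec K hK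
  obtain ⟨C, hC⟩ := stub_fastWeakL3 ν T hν hT u p hmax.1 hLH hdec K hK
  obtain ⟨M₁, hM₁⟩ :=
    stub_weakTransfer ν T hν hT u p hmax.1 hLH D t₀ C ht₀ ht₀T hD hC (hW ν T hν hT u p hmax hLH hdec)
  obtain ⟨M₂, hM₂⟩ := stub_weakL3_early ν T hν hT u p hmax.1 hLH hdec t₀ ht₀T
  refine ⟨max M₁ M₂, fun t ht => ?_⟩
  by_cases h : t < t₀
  · exact (hM₂ t ⟨ht.1, h.le⟩).trans (ENNReal.ofReal_le_ofReal (le_max_right _ _))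
  · exact (hM₁ t ⟨not_lt.mp h, ht.2⟩).trans (ENNReal.ofReal_le_ofReal (le_max_left _ _))

/-- **On the shelf, TIQG's Lorentz upgrade gives a weak-L³ terminal slice** (stmt-1574 ∧ stmt-24108 ⇒ WeakL3Trace;
Type I from the PROVED `RecordTimeTypeI`, stmt-22145). -/
theorem weakL3Trace_of_enstrophyQuarterLaw_of_lorentzUpgradeTypeI
    (hQ : Theses.StretchingWellBinding.EnstrophyQuarterLaw) (hL : Theses.TypeIQuarterGate.LorentzUpgradeTypeI) :
    WeakL3Trace := by
  intro ν T hν hT u p hmax hLH hdec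
  obtain ⟨K, hK⟩ := hQ ν T hν hT u p hmax hLH hdec
  have hI : IsTypeIBlowup u T :=
    Theorems.lerayQuarterDissipation_recordTimeTypeI_proof ν T hν hT u p hmax.1 hLH hdec K hK
  obtain ⟨M', hM'⟩ := hL ν T hν hT u p hmax hLH hdec hI
  obtain ⟨D, t₀, ht₀, ht₀T, hD⟩ := stub_edgeLaw ν T hν hT u p hmax.1 hLH hdec K hK
  exact stub_trace_of_slices ν T hν hT u p hmax.1 hLH D t₀ ht₀T hD
    ⟨M', fun s hs => hM' s ⟨ht₀.trans hs.1, hs.2⟩⟩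

/-- **On the quarter-law shelf, `LorentzUpgradeTypeI ↔ WeakL3Trace`**: TIQG's open crux restricted to the shelf is
a statement about the terminal slice alone. -/
theorem lorentzUpgradeTypeI_iff_weakL3Trace_of_enstrophyQuarterLaw
    (hQ : Theses.StretchingWellBinding.EnstrophyQuarterLaw) :
    Theses.TypeIQuarterGate.LorentzUpgradeTypeI ↔ WeakL3Trace :=
  ⟨weakL3Trace_of_enstrophyQuarterLaw_of_lorentzUpgradeTypeI hQ,
    lorentzUpgradeTypeI_of_enstrophyQuarterLaw_of_weakL3Trace hQ⟩

end Summit.NavierStokesRegularity.NavierStokesRegularity.Cruxes.EnstrophyQuarterLaw.WeakTrace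

end
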